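import Literature.NumberTheory.ComplexMultiplication.CMTypeRankSameSlotFamilies
import Summits.HodgeConjecture.CorCM.PairFlipTransportDichotomy
import HarnessLib

/-!
# Irreducible odd weights: every type is nondegenerate, same-slot families are decided by EQUIVARIANT relations
# between the type vectors, and the capacity drops from `n` to `n/d` (`d ≥ 2` as soon as multiplicity one fails)

COR-CM (cell `pub-hodgecm2`, binder seat `b16` gen 55, count-neutral claim IRR-ODD, file F1 — abstract `G`-set level;
theorems only, no definition, no named fact, no `sorry`).  NEW as stated, hence under `Summits/`.  HONEST FRAMING:
finite-dimensional linear algebra about the Kubota–Dodson rank of CM types and of SAME-SLOT families of CM types (all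
slots one `G`-set `X` — one CM field `K`, `X = Hom(K, ℂ)`), read on Hodge groups of products of abelian varieties with
complex multiplication by ONE field; `HC_CM` is neither used nor asserted.

THE HYPOTHESIS (IRR) for a `G`-stable subspace `A ≤ ℚ^X` (for CM types: `A = Anti`, the `ρ`-odd weights
`f(ρx) = −f(x)`): every non-zero `G`-stable subspace of `A` is `A` — `A` is an IRREDUCIBLE rational representation of
`G`, NOT necessarily absolutely irreducible.  The tree's multiplicity-one hypothesis (M1) of
`Literature/…/CMTypeRankSameSlotFamilies` (every equivariant `T : ℚ^X → ℚ^X` with values in `A` is a scalar multiple of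
the projection onto `A`; for CM fields ⟺ (SC) «self-conjugate stabiliser orbits», seat gen 54
`CorCM/StabiliserOrbitSelfConjugate`) is the case `End_G(A) = ℚ` of (IRR) (`antiWeights_irreducible_of_multiplicityOne`);
under (IRR) alone `D = End_G(A)` is a division algebra over `ℚ` of some dimension `d ≥ 1` (Schur), and everything that
(M1) decides by LINEAR independence of the type vectors `u_i = u_1(Φ_i) = 𝟙_{Φ_i} − 𝟙_{Φ̄_i}` is decided under (IRR) by
their independence over the EQUIVARIANT ENDOMORPHISMS:

* §1 Schur for (IRR): `injOn_of_irreducible` (an equivariant `T : ℚ^X → V` to any representation, non-zero on `A`, is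
  injective on `A`), `exists_factor_of_irreducible` (if moreover `V` is irreducible, every equivariant `T' : ℚ^X → V`
  FACTORS as `T' = T ∘ φ` with `φ` an equivariant endomorphism of `ℚ^X` with values in `A`), `antiSpan_eq_of_irreducible`
  (`U(Φ) = A` for every type vector in `A`: EVERY such type is nondegenerate).
* §2 **`forall_map_slotExt_le_iff_forall_equivariant`** — THE CRITERION: a same-slot family with type vectors in an
  (IRR) subspace `A` is ADDITIVE (`U(Σ) = ⊕_i U(Φ_i)`; `Hg(∏ A_i) = ∏ Hg(A_i)`) IFF it satisfies NO EQUIVARIANT RELATION: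
  whenever `G`-equivariant endomorphisms `φ_i` of `ℚ^X` have `Σ_i φ_i(u_i) = 0`, every `φ_i(u_i) = 0` (the evaluation
  criterion of `CMTypeRankEvaluationCriterion` needs only the representation `V = A`, where all equivariant maps from
  `ℚ^X` factor through one of them).  Under (M1) this is linear independence of the `u_i` (tree); in general it is
  independence over `D`.
* §3 **`forall_map_slotExt_le_iff_not_exists_equivariant`** — TWO slots: additive IFF NO equivariant endomorphism `L`
  of `ℚ^X` carries `u_{i₁}` to `u_{i₀}` (Goursat, `CorCM/PairFlipTransportDichotomy`, read for one slot set); under (M1)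
  `L = c·id` on `A` and this is `Φ_{i₁} ∉ {Φ_{i₀}, Φ̄_{i₀}}`, in general it is `u_{i₀} ∉ D·u_{i₁}`.
* §4 **`card_mul_le_finrank_of_irreducible`** — CAPACITY: if `d` equivariant `A`-valued endomorphisms are linearly
  independent on `A`, an additive family has `|I|·d ≤ dim A` (the vectors `T_j u_i` are linearly independent: `D·u_i ≅ D`
  and the sum `Σ_i D·u_i` is direct).
* Sequel F1b `CorCM/IrreducibleOddWeightsCMTypes` (`A = Anti` for a conjugation `ρ` commuting with `G`): EVERY CM type
  of an (IRR) slot is nondegenerate; rank / nondegeneracy forms of §2–§3; (M1) ⟹ (IRR); and if (IRR) holds but (M1)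
  FAILS (for CM fields: the field is not (SC)), the projection `f ↦ f − f∘ρ` and a non-scalar odd-valued equivariant
  `T` are independent on `Anti`, so `d ≥ 2` and every nondegenerate same-slot family has at most `n/2` members
  (`|X| = 2n`) — against `n` under (M1) (`CMTypeRankMultiplicityOne.card_le_card_div_two_of_typeRank_sigmaType_eq`).

Numerics (seat gen 54 GAP census `HOME/pub-hodgecm2-b16/lean-g54/census_rows.txt`, not kernel): of the 38 Galois types of
octic CM fields, 19 satisfy (SC) = (M1) and 8 MORE satisfy (IRR) without (M1) (closure orders 8, 8, 16, 16, 16, 16, 24 =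
`SL₂(𝔽₃)`, 32); for those `n = 4` and the census finds 4 (resp. 16) same-field partners `Ψ` of each type with
`rank(Φ, Ψ) = rank Φ` — consistent with `d = 2` (resp. `d = 4`: the Galois `C₈`- and `Q₈`-fields, capacity 1).

## References

* [Serre1977] J.-P. Serre, *Linear Representations of Finite Groups*, GTM 42 (1977), §1.3 Thm. 1, §2.2 Prop. 4 (Schur),
  §12.1–12.2 (rationality, Schur index).
* [Mai1989] L. Mai, *Lower bounds for the ranks of CM types*, J. Number Theory 32 (1989), §2 Prop. 1 (proof: `rank =
  Σ_π d_π rank π(τ)`).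
* [Kubota1965] T. Kubota, *On the field extension by complex multiplication*, Trans. AMS 118 (1965), §2 Lemma 2.
* [Gordon1999HodgeAVSurvey] B. B. Gordon, *A survey of the Hodge conjecture for abelian varieties*, §3 Theorem (Imai,
  Murty) with proof, 7.5–7.7.
* [Deligne1982HodgeCycles] P. Deligne, *Hodge cycles on abelian varieties*, LNM 900 (1982), I Ex. 3.7.
-/

set_option autoImplicit false

noncomputable section

open scoped BigOperators

universe u v w

namespace Summit.HodgeConjecture.CorCM.IrrOdd

open Literature.NumberTheory.ComplexMultiplication

variable {G : Type w} [Group G] {I : Type u} {X : Type v} [MulAction G X]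

/-! ### §1 Schur's lemma for an irreducible stable subspace of the permutation module `ℚ^X` -/

section Schur

/-- `u_1(Ψ) ≠ 0` on a nonempty slot (its values are `±1`). [folklore] -/
theorem antiVec_one_ne_zero [Nonempty X] (Ψ : Set X) : antiVec Ψ (1 : G) ≠ 0 := fun h => by
  obtain ⟨x⟩ := ‹Nonempty X›
  have hx := congrFun h x
  simp only [antiVec, Pi.zero_apply] at hx
  by_cases hm : (1 : G) • x ∈ Ψ
  · rw [translateInd_of_mem hm] at hx; norm_num at hx
  · rw [translateInd_of_not_mem hm] at hx; norm_num at hx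

/-- **Schur, first half, for an (IRR) subspace `A ≤ ℚ^X`**: a `G`-equivariant linear map `T : ℚ^X → V` to any
representation which does not kill `A` is injective on `A` (`A ∩ ker T` is a proper stable subspace of the irreducible
`A`). [cite: Serre1977, §2.2 Prop. 4] -/
theorem injOn_of_irreducible {A : Submodule ℚ (X → ℚ)}
    (hAst : ∀ (k : G) (a : X → ℚ), a ∈ A → (fun x => a (k • x)) ∈ A)
    (hirr : ∀ W : Submodule ℚ (X → ℚ), W ≤ A → W ≠ ⊥ →
      (∀ (k : G) (f : X → ℚ), f ∈ W → (fun y => f (k • y)) ∈ W) → W = A)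
    {V : Type*} [AddCommGroup V] [Module ℚ V] (π : Representation ℚ G V)
    (T : (X → ℚ) →ₗ[ℚ] V) (hT : ∀ (g : G) (f : X → ℚ), T (fun x => f (g⁻¹ • x)) = π g (T f))
    (hT0 : ¬ ∀ a ∈ A, T a = 0) : ∀ a ∈ A, T a = 0 → a = 0 := by
  intro a ha hTa
  by_contra ha0
  apply hT0
  have hW : A ⊓ LinearMap.ker T = A := by
    refine hirr _ inf_le_left (fun h => ha0 ?_) fun k f hf => ⟨hAst k f hf.1, ?_⟩
    · have hmem : a ∈ A ⊓ LinearMap.ker T := ⟨ha, hTa⟩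
      rwa [h, Submodule.mem_bot] at hmem
    · have h2 : T f = 0 := hf.2
      have h3 := hT k⁻¹ f
      rw [inv_inv] at h3
      change T (fun x => f (k • x)) = 0
      rw [h3, h2, map_zero]
  intro b hb
  rw [← hW] at hb
  exact hb.2

/-- **Schur, second half, for an (IRR) subspace `A ≤ ℚ^X` met by an IRREDUCIBLE representation `(π, V)`**: if the
equivariant `T : ℚ^X → V` does not kill `A` (so `T|_A : A ≅ V`), then EVERY equivariant `T' : ℚ^X → V` factors as
`T' = T ∘ φ` with `φ` a `G`-equivariant endomorphism of `ℚ^X` taking values in `A` (`φ = (T|_A)⁻¹ ∘ T'`; under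
multiplicity one `φ` would be a scalar multiple of the projection — here it is an arbitrary element of `Hom_G(ℚ^X, A)`).
[cite: Serre1977, §2.2 Prop. 4] -/
theorem exists_factor_of_irreducible {A : Submodule ℚ (X → ℚ)}
    (hAst : ∀ (k : G) (a : X → ℚ), a ∈ A → (fun x => a (k • x)) ∈ A)
    (hirr : ∀ W : Submodule ℚ (X → ℚ), W ≤ A → W ≠ ⊥ →
      (∀ (k : G) (f : X → ℚ), f ∈ W → (fun y => f (k • y)) ∈ W) → W = A)
    {V : Type*} [AddCommGroup V] [Module ℚ V] (π : Representation ℚ G V) (hπ : π.IsIrreducible)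
    (T : (X → ℚ) →ₗ[ℚ] V) (hT : ∀ (g : G) (f : X → ℚ), T (fun x => f (g⁻¹ • x)) = π g (T f))
    (hT0 : ¬ ∀ a ∈ A, T a = 0)
    (T' : (X → ℚ) →ₗ[ℚ] V) (hT' : ∀ (g : G) (f : X → ℚ), T' (fun x => f (g⁻¹ • x)) = π g (T' f)) :
    ∃ φ : (X → ℚ) →ₗ[ℚ] (X → ℚ), (∀ (g : G) (f : X → ℚ), φ (fun x => f (g⁻¹ • x)) = fun x => φ f (g⁻¹ • x)) ∧
      (∀ f, φ f ∈ A) ∧ ∀ f, T' f = T (φ f) := by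
  have hinj := injOn_of_irreducible hAst hirr π T hT hT0
  -- `T(A) = V` by irreducibility of `V`
  have hsurj : A.map T = ⊤ := by
    let S : Subrepresentation π := ⟨A.map T, fun g v hv => by
      obtain ⟨a, ha, rfl⟩ := hv
      exact ⟨fun x => a (g⁻¹ • x), hAst g⁻¹ a ha, hT g a⟩⟩
    rcases hπ.eq_bot_or_eq_top S with hS | hS
    · exfalso
      apply hT0
      intro a ha
      have hmem : T a ∈ (S : Subrepresentation π).toSubmodule := ⟨a, ha, rfl⟩
      rw [hS] at hmem
      exact (Submodule.mem_bot ℚ).1 hmem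
    · exact congrArg Subrepresentation.toSubmodule hS
  -- the equivariant isomorphism `e = T|_A : A ≃ V`
  have hbij : Function.Bijective (T.domRestrict A) := by
    refine ⟨fun a b hab => Subtype.ext ?_, fun v => ?_⟩
    · have h : T (a - b : A) = 0 := by
        rw [Submodule.coe_sub, map_sub]
        exact sub_eq_zero.2 hab
      exact sub_eq_zero.1 (hinj _ (a - b).2 h)
    · have hv : v ∈ A.map T := hsurj ▸ Submodule.mem_top
      obtain ⟨a, ha, rfl⟩ := hv
      exact ⟨⟨a, ha⟩, rfl⟩
  let e : A ≃ₗ[ℚ] V := LinearEquiv.ofBijective (T.domRestrict A) hbij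
  have he : ∀ a : A, e a = T a := fun a => rfl
  have hesymm : ∀ (g : G) (v : V), (e.symm (π g v) : X → ℚ) = fun x => (e.symm v : X → ℚ) (g⁻¹ • x) := by
    intro g v
    have h1 : e ⟨fun x => (e.symm v : X → ℚ) (g⁻¹ • x), hAst g⁻¹ _ (e.symm v).2⟩ = π g v := by
      rw [he]
      change T (fun x => (e.symm v : X → ℚ) (g⁻¹ • x)) = π g v
      rw [hT g, ← he, LinearEquiv.apply_symm_apply]
    have h2 := congrArg e.symm h1
    rw [LinearEquiv.symm_apply_apply] at h2
    rw [← h2]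
  refine ⟨A.subtype ∘ₗ e.symm.toLinearMap ∘ₗ T', fun g f => ?_, fun f => (e.symm (T' f)).2, fun f => ?_⟩
  · simp only [LinearMap.comp_apply, hT' g, LinearEquiv.coe_coe, Submodule.coe_subtype, hesymm]
  · change T' f = T (e.symm (T' f) : A)
    rw [← he, LinearEquiv.apply_symm_apply]

/-- **`U(Φ) = A` for every type vector in an (IRR) subspace**: the translates of `u_1(Φ) ∈ A`, `u_1(Φ) ≠ 0`, span a
non-zero stable subspace of the irreducible `A`. [cite: Kubota1965, §2 Lemma 2] [cite: Serre1977, §2.2 Prop. 4] -/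
theorem antiSpan_eq_of_irreducible [Nonempty X] {A : Submodule ℚ (X → ℚ)}
    (hAst : ∀ (k : G) (a : X → ℚ), a ∈ A → (fun x => a (k • x)) ∈ A)
    (hirr : ∀ W : Submodule ℚ (X → ℚ), W ≤ A → W ≠ ⊥ →
      (∀ (k : G) (f : X → ℚ), f ∈ W → (fun y => f (k • y)) ∈ W) → W = A)
    {Φ : Set X} (hu : antiVec Φ (1 : G) ∈ A) : antiSpan G Φ = A := by
  have hle : antiSpan G Φ ≤ A := by
    refine Submodule.span_le.2 ?_
    rintro _ ⟨g, rfl⟩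
    change antiVec Φ g ∈ A
    rw [antiVec_eq_antiVec_one_comp_smul Φ g]
    exact hAst _ _ hu
  refine hirr _ hle (fun h => antiVec_one_ne_zero (G := G) Φ ?_) fun k f hf => comp_smul_mem_antiSpan hf k
  rw [← Submodule.mem_bot ℚ, ← h]
  exact Submodule.subset_span ⟨1, rfl⟩

/-- **Schur for equivariant ENDOMORPHISMS of `ℚ^X`** (the permutation representation as target): an equivariant
`S : ℚ^X → ℚ^X` killing one non-zero vector of the (IRR) subspace `A` kills `A`. [cite: Serre1977, §2.2 Prop. 4] -/
theorem forall_apply_eq_zero_of_irreducible {A : Submodule ℚ (X → ℚ)}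
    (hAst : ∀ (k : G) (a : X → ℚ), a ∈ A → (fun x => a (k • x)) ∈ A)
    (hirr : ∀ W : Submodule ℚ (X → ℚ), W ≤ A → W ≠ ⊥ →
      (∀ (k : G) (f : X → ℚ), f ∈ W → (fun y => f (k • y)) ∈ W) → W = A)
    (S : (X → ℚ) →ₗ[ℚ] (X → ℚ)) (hS : ∀ (g : G) (f : X → ℚ), S (fun x => f (g⁻¹ • x)) = fun x => S f (g⁻¹ • x))
    {a₀ : X → ℚ} (ha₀ : a₀ ∈ A) (ha₀0 : a₀ ≠ 0) (hSa₀ : S a₀ = 0) : ∀ a ∈ A, S a = 0 := by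
  let π : Representation ℚ G (X → ℚ) :=
    { toFun := fun g => LinearMap.funLeft ℚ ℚ fun x : X => g⁻¹ • x
      map_one' := by ext f x; simp
      map_mul' := fun g h => by ext f x; simp [mul_smul] }
  by_contra hnot
  exact ha₀0 (injOn_of_irreducible hAst hirr π S (fun g f => hS g f) hnot a₀ ha₀ hSa₀)

end Schur

/-! ### §2 The criterion: additivity ⟺ no equivariant relation between the type vectors -/

section Criterion

variable [DecidableEq I] [Fintype I]

/-- **Additivity ⟹ no equivariant relation** (the evaluation criterion in the permutation representation `ℚ^X` itself;
no hypothesis on the slot): if `ext_i U(Φ_i) ≤ U(Σ)` for all `i` and equivariant endomorphisms `φ_i` of `ℚ^X` satisfy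
`Σ_i φ_i(u_1(Φ_i)) = 0`, then every `φ_i(u_1(Φ_i)) = 0`. [cite: Mai1989, §2 Prop. 1 (proof)] -/
theorem apply_antiVec_eq_zero_of_forall_map_slotExt_le (Φ : I → Set X)
    (hadd : ∀ i, (antiSpan G (Φ i)).map (slotExt (E := fun _ : I => X) i) ≤
      antiSpan G (sigmaType (E := fun _ : I => X) Φ))
    (φ : I → ((X → ℚ) →ₗ[ℚ] (X → ℚ)))
    (hφ : ∀ i (g : G) (f : X → ℚ), φ i (fun x => f (g⁻¹ • x)) = fun x => φ i f (g⁻¹ • x))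
    (hsum : ∑ i, φ i (antiVec (Φ i) (1 : G)) = 0) (i : I) : φ i (antiVec (Φ i) (1 : G)) = 0 := by
  let π : Representation ℚ G (X → ℚ) :=
    { toFun := fun g => LinearMap.funLeft ℚ ℚ fun x : X => g⁻¹ • x
      map_one' := by ext f x; simp
      map_mul' := fun g h => by ext f x; simp [mul_smul] }
  exact eval_eq_zero_of_forall_map_slotExt_le (E := fun _ : I => X) Φ hadd π φ (fun i g f => hφ i g f) hsum i

variable [Fintype X]

/-- **THE CRITERION FOR AN (IRR) SLOT.**  A same-slot family whose type vectors lie in an (IRR) subspace `A ≤ ℚ^X` is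
additive — `U(Σ) = ⊕_i U(Φ_i)`, `rank(Σ) − 1 = Σ_i (rank Φ_i − 1)`, on Hodge groups `Hg(∏ A_i) = ∏ Hg(A_i)` — IFF the
type vectors satisfy NO EQUIVARIANT RELATION: for all `G`-equivariant endomorphisms `φ_i` of `ℚ^X`,
`Σ_i φ_i(u_1(Φ_i)) = 0 ⟹ ∀ i, φ_i(u_1(Φ_i)) = 0`.  (⟸: in an irreducible `V` either all equivariant `T_i : ℚ^X → V`
kill `A`, or one of them restricts to `A ≅ V` and the others factor through it by §1; the relation pulls back to `A`.)
[cite: Mai1989, §2 Prop. 1 (proof)] [cite: Serre1977, §2.2 Prop. 4] -/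
theorem forall_map_slotExt_le_iff_forall_equivariant {A : Submodule ℚ (X → ℚ)}
    (hAst : ∀ (k : G) (a : X → ℚ), a ∈ A → (fun x => a (k • x)) ∈ A)
    (hirr : ∀ W : Submodule ℚ (X → ℚ), W ≤ A → W ≠ ⊥ →
      (∀ (k : G) (f : X → ℚ), f ∈ W → (fun y => f (k • y)) ∈ W) → W = A)
    (Φ : I → Set X) (hu : ∀ i, antiVec (Φ i) (1 : G) ∈ A) :
    (∀ i, (antiSpan G (Φ i)).map (slotExt (E := fun _ : I => X) i) ≤
        antiSpan G (sigmaType (E := fun _ : I => X) Φ)) ↔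
      ∀ φ : I → ((X → ℚ) →ₗ[ℚ] (X → ℚ)),
        (∀ i (g : G) (f : X → ℚ), φ i (fun x => f (g⁻¹ • x)) = fun x => φ i f (g⁻¹ • x)) →
        ∑ i, φ i (antiVec (Φ i) (1 : G)) = 0 → ∀ i, φ i (antiVec (Φ i) (1 : G)) = 0 := by
  refine ⟨fun hadd φ hφ hsum => apply_antiVec_eq_zero_of_forall_map_slotExt_le Φ hadd φ hφ hsum, fun hind => ?_⟩
  refine forall_map_slotExt_le_of_forall_irreducible (E := fun _ : I => X) Φ fun V _ _ _ π hπ T hT hsum => ?_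
  by_cases hall : ∀ j, ∀ a ∈ A, T j a = 0
  · exact fun j => hall j _ (hu j)
  push Not at hall
  obtain ⟨j₀, hj₀⟩ := hall
  have hj₀' : ¬ ∀ a ∈ A, T j₀ a = 0 := by
    push Not
    exact hj₀
  have hinj := injOn_of_irreducible hAst hirr π (T j₀) (hT j₀) hj₀'
  choose φ hφeq hφA hφT using
    fun j => exists_factor_of_irreducible hAst hirr π hπ (T j₀) (hT j₀) hj₀' (T j) (hT j)
  have hzero : ∑ j, φ j (antiVec (Φ j) (1 : G)) = 0 := by
    refine hinj _ (A.sum_mem fun j _ => hφA j _) ?_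
    rw [map_sum]
    simpa only [← hφT] using hsum
  intro j
  rw [hφT j, hind φ hφeq hzero j, map_zero]

end Criterion

/-! ### §3 Two slots: additive ⟺ no equivariant endomorphism carries one type vector to the other -/

section TwoSlots

variable [DecidableEq I] [Fintype I] [Fintype X] [Nonempty X] {i₀ i₁ : I}

/-- `I = {i₀, i₁}`: the universal finite set. [folklore] -/
theorem univ_eq_pair (hI : ∀ j, j = i₀ ∨ j = i₁) : (Finset.univ : Finset I) = {i₀, i₁} := by
  ext j
  simp only [Finset.mem_univ, Finset.mem_insert, Finset.mem_singleton, true_iff]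
  exact hI j

/-- **TWO SLOTS OVER ONE (IRR) SLOT SET.**  `I = {i₀, i₁}`, both type vectors in the (IRR) subspace `A`: the pair is
additive (`Hg(A₀ × A₁) = Hg(A₀) × Hg(A₁)`) IFF there is NO `G`-equivariant endomorphism `L` of `ℚ^X` with
`L(u_1(Φ_{i₁})) = u_1(Φ_{i₀})`.  (⟹: `L u_{i₁} − u_{i₀} = 0` would be an equivariant relation with `−u_{i₀} ≠ 0`;
⟸: Goursat's dichotomy `PairFlipTransport.additive_or_exists_collapse_of_irreducible` for the irreducible `U(Φ_{i₀}) = A`.)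
Under (M1) `L|_A` is a scalar and the condition reads `u_{i₀} ∉ ℚ u_{i₁}`; under (IRR) it reads `u_{i₀} ∉ D·u_{i₁}`,
`D = End_G(A)`. [cite: Gordon1999HodgeAVSurvey, §3 Theorem (proof) and 7.5–7.7] [cite: Serre1977, §2.2 Prop. 4] -/
theorem forall_map_slotExt_le_iff_not_exists_equivariant (hI : ∀ j, j = i₀ ∨ j = i₁) (h01 : i₀ ≠ i₁)
    {A : Submodule ℚ (X → ℚ)}
    (hAst : ∀ (k : G) (a : X → ℚ), a ∈ A → (fun x => a (k • x)) ∈ A)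
    (hirr : ∀ W : Submodule ℚ (X → ℚ), W ≤ A → W ≠ ⊥ →
      (∀ (k : G) (f : X → ℚ), f ∈ W → (fun y => f (k • y)) ∈ W) → W = A)
    (Φ : I → Set X) (hu : ∀ i, antiVec (Φ i) (1 : G) ∈ A) :
    (∀ i, (antiSpan G (Φ i)).map (slotExt (E := fun _ : I => X) i) ≤
        antiSpan G (sigmaType (E := fun _ : I => X) Φ)) ↔
      ¬ ∃ L : (X → ℚ) →ₗ[ℚ] (X → ℚ), (∀ (g : G) (f : X → ℚ), L (fun y => f (g • y)) = fun x => L f (g • x)) ∧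
        L (antiVec (Φ i₁) (1 : G)) = antiVec (Φ i₀) (1 : G) := by
  constructor
  · rintro hadd ⟨L, hL, hLu⟩
    let φ : I → ((X → ℚ) →ₗ[ℚ] (X → ℚ)) := fun i => if i = i₁ then L else -LinearMap.id
    have hφ : ∀ i (g : G) (f : X → ℚ), φ i (fun x => f (g⁻¹ • x)) = fun x => φ i f (g⁻¹ • x) := by
      intro i g f
      by_cases hi : i = i₁
      · simp only [φ, if_pos hi, hL g⁻¹ f]
      · simp only [φ, if_neg hi, LinearMap.neg_apply, LinearMap.id_apply]
        rfl
    have hsum : ∑ i, φ i (antiVec (Φ i) (1 : G)) = 0 := by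
      rw [univ_eq_pair hI, Finset.sum_pair h01]
      simp only [φ, if_neg h01, if_pos rfl, hLu, LinearMap.neg_apply, LinearMap.id_apply, neg_add_cancel]
    have h0 := apply_antiVec_eq_zero_of_forall_map_slotExt_le Φ hadd φ hφ hsum i₀
    simp only [φ, if_neg h01, LinearMap.neg_apply, LinearMap.id_apply, neg_eq_zero] at h0
    exact antiVec_one_ne_zero (G := G) (Φ i₀) h0
  · intro hno
    have hirr₀ : ∀ W : Submodule ℚ (X → ℚ), W ≤ antiSpan G (Φ i₀) → W ≠ ⊥ →
        (∀ (k : G) (f : X → ℚ), f ∈ W → (fun y => f (k • y)) ∈ W) → W = antiSpan G (Φ i₀) := by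
      rw [antiSpan_eq_of_irreducible hAst hirr (hu i₀)]
      exact hirr
    rcases PairFlipTransport.additive_or_exists_collapse_of_irreducible (E := fun _ : I => X) (Φ := Φ) hI h01 hirr₀
      with hadd | ⟨L, hL, -, hLu⟩
    · exact hadd
    · exact absurd ⟨L, hL, hLu⟩ hno

/-- **Symmetric form**: both type vectors in the (IRR) subspace `A`, so the roles of `i₀`, `i₁` may be exchanged —
additive IFF no equivariant `L` with `L(u_1(Φ_{i₀})) = u_1(Φ_{i₁})`. [cite: Gordon1999HodgeAVSurvey, §3 Theorem (proof) and 7.5–7.7] -/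
theorem forall_map_slotExt_le_iff_not_exists_equivariant' (hI : ∀ j, j = i₀ ∨ j = i₁) (h01 : i₀ ≠ i₁)
    {A : Submodule ℚ (X → ℚ)}
    (hAst : ∀ (k : G) (a : X → ℚ), a ∈ A → (fun x => a (k • x)) ∈ A)
    (hirr : ∀ W : Submodule ℚ (X → ℚ), W ≤ A → W ≠ ⊥ →
      (∀ (k : G) (f : X → ℚ), f ∈ W → (fun y => f (k • y)) ∈ W) → W = A)
    (Φ : I → Set X) (hu : ∀ i, antiVec (Φ i) (1 : G) ∈ A) :
    (∀ i, (antiSpan G (Φ i)).map (slotExt (E := fun _ : I => X) i) ≤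
        antiSpan G (sigmaType (E := fun _ : I => X) Φ)) ↔
      ¬ ∃ L : (X → ℚ) →ₗ[ℚ] (X → ℚ), (∀ (g : G) (f : X → ℚ), L (fun y => f (g • y)) = fun x => L f (g • x)) ∧
        L (antiVec (Φ i₀) (1 : G)) = antiVec (Φ i₁) (1 : G) :=
  forall_map_slotExt_le_iff_not_exists_equivariant (fun j => (hI j).symm) (Ne.symm h01) hAst hirr Φ hu

end TwoSlots

/-! ### §4 Capacity: `|I| · d ≤ dim A` -/

section Capacity

variable [DecidableEq I] [Fintype I] [Fintype X] [Nonempty X]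

/-- **CAPACITY OF AN (IRR) SLOT.**  If `T_1, …, T_d` are `G`-equivariant endomorphisms of `ℚ^X` with values in the
(IRR) subspace `A` whose restrictions to `A` are linearly independent, then every ADDITIVE same-slot family with type
vectors in `A` has `|I| · d ≤ dim A`: the `|I|·d` vectors `T_j(u_1(Φ_i)) ∈ A` are linearly independent (a relation
`Σ_{i,j} c_{ij} T_j u_i = 0` is an equivariant relation `Σ_i φ_i u_i = 0`, `φ_i = Σ_j c_{ij} T_j`, so each `φ_i u_i = 0`;
`φ_i` kills a non-zero vector of `A`, hence `A` (§1), hence `c_{ij} = 0`).  Under (M1), `d = 1`; in general `d` may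
be taken `= dim_ℚ End_G(A)`. [cite: Mai1989, §2 Prop. 1 (proof)] [cite: Serre1977, §2.2 Prop. 4 and §12.2] -/
theorem card_mul_le_finrank_of_irreducible {A : Submodule ℚ (X → ℚ)}
    (hAst : ∀ (k : G) (a : X → ℚ), a ∈ A → (fun x => a (k • x)) ∈ A)
    (hirr : ∀ W : Submodule ℚ (X → ℚ), W ≤ A → W ≠ ⊥ →
      (∀ (k : G) (f : X → ℚ), f ∈ W → (fun y => f (k • y)) ∈ W) → W = A)
    (Φ : I → Set X) (hu : ∀ i, antiVec (Φ i) (1 : G) ∈ A)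
    (hadd : ∀ i, (antiSpan G (Φ i)).map (slotExt (E := fun _ : I => X) i) ≤
      antiSpan G (sigmaType (E := fun _ : I => X) Φ))
    {d : ℕ} (T : Fin d → ((X → ℚ) →ₗ[ℚ] (X → ℚ)))
    (hT : ∀ j (g : G) (f : X → ℚ), T j (fun x => f (g⁻¹ • x)) = fun x => T j f (g⁻¹ • x))
    (hTA : ∀ j f, T j f ∈ A)
    (hTli : ∀ c : Fin d → ℚ, (∀ a ∈ A, ∑ j, c j • T j a = 0) → ∀ j, c j = 0) :
    Fintype.card I * d ≤ Module.finrank ℚ A := by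
  let v : I × Fin d → A := fun p => ⟨T p.2 (antiVec (Φ p.1) (1 : G)), hTA _ _⟩
  have hli : LinearIndependent ℚ v := by
    rw [Fintype.linearIndependent_iff]
    intro c hc
    let φ : I → ((X → ℚ) →ₗ[ℚ] (X → ℚ)) := fun i => ∑ j, c (i, j) • T j
    have hφapp : ∀ i f, φ i f = ∑ j, c (i, j) • T j f := fun i f => by
      simp only [φ, LinearMap.sum_apply, LinearMap.smul_apply]
    have hφ : ∀ i (g : G) (f : X → ℚ), φ i (fun x => f (g⁻¹ • x)) = fun x => φ i f (g⁻¹ • x) := by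
      intro i g f
      rw [hφapp, hφapp]
      funext x
      simp only [Finset.sum_apply, Pi.smul_apply, hT _ g f]
    have hsum : ∑ i, φ i (antiVec (Φ i) (1 : G)) = 0 := by
      have h1 := congrArg Subtype.val hc
      rw [Submodule.coe_sum, Fintype.sum_prod_type] at h1
      simp only [Submodule.coe_smul, v, Submodule.coe_zero] at h1
      simpa only [hφapp] using h1
    have hi : ∀ i, φ i (antiVec (Φ i) (1 : G)) = 0 :=
      apply_antiVec_eq_zero_of_forall_map_slotExt_le Φ hadd φ hφ hsum
    rintro ⟨i, j⟩
    have hall : ∀ a ∈ A, φ i a = 0 :=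
      forall_apply_eq_zero_of_irreducible hAst hirr (φ i) (hφ i) (hu i) (antiVec_one_ne_zero (Φ i)) (hi i)
    exact hTli (fun j => c (i, j)) (fun a ha => by rw [← hφapp]; exact hall a ha) j
  have h := hli.fintype_card_le_finrank
  rwa [Fintype.card_prod, Fintype.card_fin] at h

end Capacity

end Summit.HodgeConjecture.CorCM.IrrOdd

end
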